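import Summits.ResolutionOfSingularities.ResolutionOfSingularities.Theorems.FrobeniusClosingSteerLowTowerMoves
import Summits.ResolutionOfSingularities.ResolutionOfSingularities.Theorems.FrobeniusClosingSteerLowTowerTorsor
import Summits.ResolutionOfSingularities.ResolutionOfSingularities.Theorems.FrobeniusClosingSteerLowTowerFrame
import Summits.ResolutionOfSingularities.ResolutionOfSingularities.Theorems.FrobeniusClosingSteerLowTowerFrameImage
import Summits.ResolutionOfSingularities.ResolutionOfSingularities.Theorems.FrobeniusClosingSteerLowTowerCritical
import Summits.ResolutionOfSingularities.ResolutionOfSingularities.Theorems.FrobeniusClosingSteerLowTowerPointChart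
import Summits.ResolutionOfSingularities.ResolutionOfSingularities.Theorems.FrobeniusClosingSteerLowTowerStages
import Summits.ResolutionOfSingularities.ResolutionOfSingularities.Theorems.FrobeniusClosingSteerLowTowerDescent
import Summits.ResolutionOfSingularities.ResolutionOfSingularities.Theorems.FrobeniusClosingSteerLowTowerField
import Summits.ResolutionOfSingularities.ResolutionOfSingularities.Theorems.FrobeniusClosingSteerLowTowerCurveStage
import Summits.ResolutionOfSingularities.ResolutionOfSingularities.Theorems.FrobeniusClosingSteerLowTowerStepImages
import Summits.ResolutionOfSingularities.ResolutionOfSingularities.Theorems.FrobeniusClosingSteerLowTowerResidueTrdeg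
import Summits.ResolutionOfSingularities.ResolutionOfSingularities.Theorems.FrobeniusClosingSteerSteeredExit
import Literature.AlgebraicGeometry.Resolution.LocalBlowup
import Literature.AlgebraicGeometry.Resolution.RsopMonomialIdeals
import Mathlib.RingTheory.AdjoinRoot
import HarnessLib

/-!
# D3a ASSEMBLY: the LOW tower exists (`LowTowerExistsTwo`, hypothesis form)
(res-D-pv-012 AS res-L0-w41-stub-8; W4.1 crux `Steer` stmt-ResolutionOfSingularities-16345, LOW branch, strat-2 §σ2.24 D3a; RULING 42:
(A1)(A3)(A5)+assembly = pv-012, (A2) = res-L0-w41-stub-3 (`hthread`, `hinv`), (A4) = res-type-026 (`trdeg_eq_two_of_surfaceGerm`),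
(A1′) = res-type-072.) OURS; AI.

`exists_lowTower` concludes the body of `IsLowTowerTwo k L A Y h T x g pt` (skeleton of record r32, with the skeleton-level predicates
`IsPartialNormalisation`, `IsIntegralOver`, `IsSingPrime`/`RadicandRing` UNFOLDED verbatim) from hypotheses on the run read UPSTAIRS in
`K` through the local ring `Λ = (R i₀)_𝔮` at the critical prime (tree vocabulary only; the skeleton leaf `lowTowerExistsTwo_holds`
instantiates them from `IsSteeredRun`, the threading theorem of res-L0-w41-stub-3 and the σ_top semantics).
-/

noncomputable section
set_option linter.dupNamespace false

namespace Summit.ResolutionOfSingularities.ResolutionOfSingularities.Theorems.SwitchingDichotomy.LowTower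

open IsLocalRing Polynomial
open Literature.AlgebraicGeometry.Resolution

variable {k K : Type} [Field k] [CharP k 2] [Field K] [CharP K 2] [Algebra k K]

/-- **D3a (assembly, hypothesis form): the LOW tower of a steered run read on the critical surface.** Inputs, all UPSTAIRS in `K`:
the sub-run `R (i₀ + ·)` from the first all-LOW stage (local blow-ups along a valuation ring `O` zero-dimensional over `k`, members of
dimension `4` with perfect residue fields, a finitely generated model at `i₀`), the critical prime `𝔮` of `R i₀` and `Λ = (R i₀)_𝔮`
inside `K` ((Λ1)(Λ2)(Λ4) of `exists_subring_locAtPrime`), the THREADING data `hthread` (every later member lies in `Λ`, with the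
point-step / curve-step chart shapes) and `hinv` (the trace of `𝔪_Λ` on each member is generated by a Jacobian pair `δ₁ f, δ₂ f` which
is part of a regular system of parameters, unit Hessian), cleaned singularity of every stage `hT4`, non-singularity of the torsor at
the generic point of the critical surface `hns` and, at point stages, at the regular non-closed curves of ANY surjective image `S`
of the member with kernel the critical prime `hT9` (σ_top semantics + the critical-surface dictionary C7), and res-type-026's
dimension formula `trdeg_eq_two_of_surfaceGerm`. Output: a field `L = κ(𝔮)(√h₀)` over `k` and the tower `A n := φ(R (i₀ + n))`,
`Y n := A n[T n]`, `h n := φ(s²)`, `T (n+1) := (T n − g n)/x n`, with all clauses (T0)–(T9) of `IsLowTowerTwo`. OURS.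
[cite: Cutkosky2014, §2.1] [cite: Lipman1978, (1.32)] [folklore] -/
theorem exists_lowTower
    (O : ValuationSubring K) (R : ℕ → Subring K) (s : ℕ → K) (i₀ : ℕ)
    (hzd : ∀ x ∈ O, ∃ f : Polynomial k, f ≠ 0 ∧ Polynomial.aeval x f ∈ O.nonunits)
    (B : Subalgebra k K) (hB : B.FG) (hBO : B.toSubring ≤ O.toSubring) (hRB : R i₀ = locAtCentre B.toSubring O)
    (hbl : ∀ n, IsLocalBlowup O (R (i₀ + n)) (R (i₀ + n + 1)))
    (hdim : ∀ n, ringKrullDim (R (i₀ + n)) = (4 : ℕ))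
    (hperf : ∀ n (hl : IsLocalRing (R (i₀ + n))) (a : R (i₀ + n)), ∃ b : R (i₀ + n), a - b ^ 2 ∈ @maximalIdeal _ _ hl)
    (𝔮 : Ideal (R i₀)) [𝔮.IsPrime] (Λ : Subring K) (h1 : R i₀ ≤ Λ)
    (h2 : ∀ r (hr : r ∈ R i₀), (⟨r, hr⟩ : R i₀) ∉ 𝔮 → r⁻¹ ∈ Λ)
    (h4 : ∀ z ∈ Λ, ∃ a u : K, ∃ (_ : a ∈ R i₀) (hu : u ∈ R i₀), (⟨u, hu⟩ : R i₀) ∉ 𝔮 ∧ z = a / u)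
    (pt : Set ℕ)
    (hthread : ∀ n : ℕ, R (i₀ + n) ≤ Λ ∧ SubringDominates (R (i₀ + n)) (R (i₀ + n + 1)) ∧
      ∃ x G : K, ∃ hx : x ∈ R (i₀ + n), G ∈ R (i₀ + n) ∧ x ≠ 0 ∧ ¬ IsUnit (⟨x, hx⟩ : R (i₀ + n)) ∧
        s (i₀ + n) = x * s (i₀ + n + 1) + G ∧
        (n ∈ pt → (∀ y (hy : y ∈ R (i₀ + n)), ¬ IsUnit (⟨y, hy⟩ : R (i₀ + n)) → y / x ∈ O) ∧
          ∀ hl : IsLocalRing (R (i₀ + n)), R (i₀ + n + 1) = locAtCentre (@blowupRing K _ (R (i₀ + n)) hl x) O) ∧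
        (n ∉ pt → ∃ S : Finset K, (↑S : Set K) ⊆ ↑O ∧
          (∀ z ∈ S, ∃ r ∈ R (i₀ + n), ∃ hzr : z - r ∈ Λ, ¬ IsUnit (⟨z - r, hzr⟩ : Λ)) ∧
          R (i₀ + n + 1) = locAtCentre (Subring.closure ((R (i₀ + n) : Set K) ∪ ↑S)) O))
    (hinv : ∀ n : ℕ, ∃ (hle : R (i₀ + n) ≤ Λ) (_ : IsLocalRing (R (i₀ + n))) (hs : s (i₀ + n) ^ 2 ∈ R (i₀ + n))
      (δ₁ δ₂ : Derivation ℤ (R (i₀ + n)) (R (i₀ + n))),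
      (∀ r : R (i₀ + n), r ∈ Ideal.span {δ₁ ⟨s (i₀ + n) ^ 2, hs⟩, δ₂ ⟨s (i₀ + n) ^ 2, hs⟩} ↔
        ¬ IsUnit (⟨(r : K), hle r.2⟩ : Λ)) ∧
      IsRsopPart ![δ₁ ⟨s (i₀ + n) ^ 2, hs⟩, δ₂ ⟨s (i₀ + n) ^ 2, hs⟩] ∧
      IsUnit (δ₁ (δ₁ ⟨s (i₀ + n) ^ 2, hs⟩) * δ₂ (δ₂ ⟨s (i₀ + n) ^ 2, hs⟩) -
        δ₁ (δ₂ ⟨s (i₀ + n) ^ 2, hs⟩) * δ₂ (δ₁ ⟨s (i₀ + n) ^ 2, hs⟩)))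
    (hT4 : ∀ n (hl : IsLocalRing (R (i₀ + n))) (hs : s (i₀ + n) ^ 2 ∈ R (i₀ + n)),
      ∃ γ : R (i₀ + n), (⟨s (i₀ + n) ^ 2, hs⟩ : R (i₀ + n)) - γ ^ 2 ∈ (@maximalIdeal _ _ hl) ^ 2)
    (hns : ∀ n (hle : R (i₀ + n) ≤ Λ) (hs : s (i₀ + n) ^ 2 ∈ R (i₀ + n)) (Q : Ideal (R (i₀ + n))) [Q.IsPrime],
      (∀ r : R (i₀ + n), r ∈ Q ↔ ¬ IsUnit (⟨(r : K), hle r.2⟩ : Λ)) →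
      IsRegularLocalRing (AdjoinRoot ((X : (Localization.AtPrime Q)[X]) ^ 2 -
        C (algebraMap (R (i₀ + n)) (Localization.AtPrime Q) ⟨s (i₀ + n) ^ 2, hs⟩))))
    (hT9 : ∀ n ∈ pt, ∀ (hle : R (i₀ + n) ≤ Λ) (hs : s (i₀ + n) ^ 2 ∈ R (i₀ + n))
      (S : Type) [CommRing S] [IsLocalRing S] (ρ : R (i₀ + n) →+* S), Function.Surjective ρ →
      (∀ r : R (i₀ + n), ρ r = 0 ↔ ¬ IsUnit (⟨(r : K), hle r.2⟩ : Λ)) →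
      ∀ (Q : Ideal S) [Q.IsPrime], Q ≠ ⊥ → Q ≠ maximalIdeal S → IsRegularLocalRing (S ⧸ Q) →
      IsRegularLocalRing (AdjoinRoot ((X : (Localization.AtPrime Q)[X]) ^ 2 -
        C (algebraMap S (Localization.AtPrime Q) (ρ ⟨s (i₀ + n) ^ 2, hs⟩))))) :
    ∃ (L : Type) (_ : Field L) (_ : Algebra k L) (A Y : ℕ → Subalgebra k L) (h T x g : ℕ → L),
      ∃ (_ : CharP L 2) (hAl : ∀ n, IsLocalRing (A n).toSubring),
        -- (T0) frame of the field
        Algebra.trdeg k L = 2 ∧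
        -- (T1) surface germs
        (∀ n, IsRegularLocalRing (A n).toSubring ∧ ringKrullDim (A n).toSubring = (2 : ℕ) ∧
          Algebra.EssFiniteType k (A n) ∧
          ∀ a : (A n).toSubring, ∃ b : (A n).toSubring, a - b ^ 2 ∈ @maximalIdeal _ _ (hAl n)) ∧
        -- (T2) members, their frame and their presentation
        (∀ n, h n ∈ A n ∧ T n ^ 2 = h n ∧
          (Y n).toSubring = Subring.closure (insert (T n) ((A n : Set L))) ∧
          IsLocalRing (Y n) ∧ Algebra.EssFiniteType k (Y n) ∧ IsFractionRing (Y n) L) ∧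
        -- (T3) hygiene
        (∀ n, ∀ u v : L, u ∈ A n → v ∈ A n → v ≠ 0 → (u / v) ^ 2 ≠ h n) ∧
        -- (T4) order descent
        (∀ n (hh : h n ∈ A n), ∃ γ : (A n).toSubring,
          (⟨h n, hh⟩ : (A n).toSubring) - γ ^ 2 ∈ (@maximalIdeal _ _ (hAl n)) ^ 2) ∧
        -- (T5) step data and laws
        (∀ n, g n ∈ A n ∧ x n ≠ 0 ∧ (∃ hx : x n ∈ A n, (⟨x n, hx⟩ : (A n).toSubring) ∈ @maximalIdeal _ _ (hAl n)) ∧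
          h (n + 1) * x n ^ 2 = h n - g n ^ 2 ∧ T (n + 1) * x n = T n - g n) ∧
        -- (T6) point stages
        (∀ n ∈ pt,
          @Literature.AlgebraicGeometry.Resolution.blowupRing _ _ (A n).toSubring (hAl n) (x n) ≤ (A (n + 1)).toSubring ∧
          (∀ z ∈ A (n + 1), ∃ a ∈ @Literature.AlgebraicGeometry.Resolution.blowupRing _ _ (A n).toSubring (hAl n) (x n),
            ∃ b ∈ @Literature.AlgebraicGeometry.Resolution.blowupRing _ _ (A n).toSubring (hAl n) (x n), b⁻¹ ∈ A (n + 1) ∧ z = a / b) ∧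
          SubringDominates (A n).toSubring (A (n + 1)).toSubring ∧
          IsQuadraticTransform (Y n).toSubring (Y (n + 1)).toSubring) ∧
        -- (T7) curve stages
        (∀ n ∉ pt, A (n + 1) = A n ∧ ((Y n).toSubring ≤ (Y (n + 1)).toSubring ∧ (Y n).toSubring ≠ (Y (n + 1)).toSubring ∧
            IsLocalRing (Y (n + 1)).toSubring ∧
            ∀ z ∈ (Y (n + 1)).toSubring, ∃ q : Polynomial L, q.Monic ∧ (∀ i, q.coeff i ∈ (Y n).toSubring) ∧ q.eval z = 0) ∧
          ¬ IsQuadraticTransform (Y n).toSubring (Y (n + 1)).toSubring) ∧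
        -- (T9) σ_top read on the surface
        (∀ n ∈ pt, ∀ (Q : Ideal (A n).toSubring) [Q.IsPrime], Q ≠ ⊥ → Q ≠ @maximalIdeal _ _ (hAl n) →
          IsRegularLocalRing ((A n).toSubring ⧸ Q) →
          ∀ hh : h n ∈ A n, ¬ ¬ IsRegularLocalRing (AdjoinRoot ((Polynomial.X : Polynomial (Localization.AtPrime Q)) ^ 2 -
            Polynomial.C (algebraMap (A n).toSubring (Localization.AtPrime Q) ⟨h n, hh⟩))))
 := by
  classical
  haveI : Fact (Nat.Prime 2) := ⟨Nat.prime_two⟩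
  /- ### 0. Unpacking the threading data -/
  have hleR : ∀ n, R (i₀ + n) ≤ Λ := fun n => (hthread n).1
  have hdomR : ∀ n, SubringDominates (R (i₀ + n)) (R (i₀ + n + 1)) := fun n => (hthread n).2.1
  choose xu Gu hxu hGu hx0 hxnu hstep hptd hcvd using fun n => (hthread n).2.2
  choose hle hl hs δ₁ δ₂ htr hrsop hhess using hinv
  haveI hlI : ∀ n, IsLocalRing (R (i₀ + n)) := hl
  have hregR : ∀ n, IsRegularLocalRing (R (i₀ + n)) := fun n => (hrsop n).1
  set f : ∀ n, R (i₀ + n) := fun n => ⟨s (i₀ + n) ^ 2, hs n⟩ with hfdef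
  have hsp : ∀ n, Ideal.span (Set.range ![δ₁ n (f n), δ₂ n (f n)]) = Ideal.span {δ₁ n (f n), δ₂ n (f n)} :=
    fun n => CriticalSurface.span_range_pair _ _
  haveI hqprime : ∀ n, (Ideal.span {δ₁ n (f n), δ₂ n (f n)}).IsPrime := fun n => hsp n ▸ (hrsop n).isPrime_span_range
  /- ### 1. `Λ` is local; members lie in `O` and contain `k` -/
  haveI hΛl : IsLocalRing Λ := isLocalRing_of_locAtPrime (R i₀) Λ 𝔮 h1 h2 h4
  have hRO : ∀ n, R (i₀ + n) ≤ O.toSubring := fun n => (hbl n).1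
  have hkR : ∀ n (c : k), algebraMap k K c ∈ R (i₀ + n) := by
    intro n
    induction n with
    | zero => intro c; rw [Nat.add_zero, hRB]; exact le_locAtCentre _ O (B.algebraMap_mem c)
    | succ n ih => intro c; exact (hdomR n).1 (ih c)
  have hkΛ : ∀ c : k, algebraMap k K c ∈ Λ := fun c => hle 0 (hkR 0 c)
  /- ### 2. (T3) upstairs: `f·v² − u² ∉ 𝔮_n` for `v ∉ 𝔮_n` -/
  have hT3up : ∀ n (u v : R (i₀ + n)), v ∉ Ideal.span {δ₁ n (f n), δ₂ n (f n)} → f n * v ^ 2 - u ^ 2 ∉ Ideal.span {δ₁ n (f n), δ₂ n (f n)} := by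
    intro n u v hv
    haveI := hregR n
    exact mul_sq_sub_sq_not_mem_of_regular (f n) (δ₁ n) (δ₂ n) (hhess n) _ rfl (hns n (hle n) (hs n) _ (htr n)) u v hv
  /- ### 3. The residue field `κ = κ(𝔮)` and the field `L = κ(√h₀)` -/
  let φ : Λ →+* ResidueField Λ := residue Λ
  have hkerφ : ∀ r : Λ, φ r = 0 ↔ ¬ IsUnit r := fun r => by
    rw [residue_eq_zero_iff, mem_maximalIdeal, mem_nonunits_iff]
  have htrφ : ∀ n (r : R (i₀ + n)), φ ⟨(r : K), hle n r.2⟩ = 0 ↔ r ∈ Ideal.span {δ₁ n (f n), δ₂ n (f n)} :=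
    fun n r => by rw [hkerφ, htr n r]
  have hnsq : ∀ c : ResidueField Λ, c ^ 2 ≠ φ ⟨s (i₀ + 0) ^ 2, hle 0 (hs 0)⟩ := by
    intro c hc
    obtain ⟨a, u, ha, hu, huP, hφu, rfl⟩ := exists_residue_div_eq (R i₀) Λ 𝔮 h1 h2 h4 c
    set uR : R (i₀ + 0) := ⟨u, hu⟩ with huR
    set aR : R (i₀ + 0) := ⟨a, ha⟩ with haR
    have hua : uR ∉ Ideal.span {δ₁ 0 (f 0), δ₂ 0 (f 0)} := by
      rw [← htrφ 0]; exact hφu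
    apply hT3up 0 aR uR hua
    rw [← htrφ 0]
    set d : R (i₀ + 0) := f 0 * uR ^ 2 - aR ^ 2 with hd
    have : (⟨(d : K), hle 0 d.2⟩ : Λ) = ⟨s (i₀ + 0) ^ 2, hle 0 (hs 0)⟩ * ⟨u, h1 hu⟩ ^ 2 - ⟨a, h1 ha⟩ ^ 2 := Subtype.ext rfl
    rw [this, map_sub, map_mul, map_pow, map_pow, ← hc, div_pow, div_mul_cancel₀ _ (pow_ne_zero 2 hφu), sub_self]
  obtain ⟨L, _instL, _instκL, halg, T₀, hT₀, hgen⟩ :=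
    exists_quadratic_extension (ResidueField Λ) (φ ⟨s (i₀ + 0) ^ 2, hle 0 (hs 0)⟩) hnsq
  letI algkΛ : Algebra k Λ := ((algebraMap k K).codRestrict Λ hkΛ).toAlgebra
  letI algkκ : Algebra k (ResidueField Λ) := (φ.comp (algebraMap k Λ)).toAlgebra
  letI algkL : Algebra k L := ((algebraMap (ResidueField Λ) L).comp (algebraMap k (ResidueField Λ))).toAlgebra
  haveI : IsScalarTower k (ResidueField Λ) L := IsScalarTower.of_algebraMap_eq (fun _ => rfl)
  haveI : CharP L 2 := charP_of_injective_algebraMap (algebraMap k L).injective 2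
  let φL : Λ →+* L := (algebraMap (ResidueField Λ) L).comp φ
  have hφLk : ∀ c : k, φL ⟨algebraMap k K c, hkΛ c⟩ = algebraMap k L c := fun _ => rfl
  have hφk : ∀ c : k, φ ⟨algebraMap k K c, hkΛ c⟩ = algebraMap k (ResidueField Λ) c := fun _ => rfl
  have hkerL : ∀ r : Λ, φL r = 0 ↔ ¬ IsUnit r := fun r => by
    rw [← hkerφ]; exact (algebraMap (ResidueField Λ) L).injective.eq_iff' (map_zero _)
  have hkerL' : ∀ r : Λ, φL r = 0 → ¬ IsUnit r := fun r => (hkerL r).mp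
  have htrL : ∀ n (r : R (i₀ + n)), φL ⟨(r : K), hle n r.2⟩ = 0 ↔ r ∈ Ideal.span {δ₁ n (f n), δ₂ n (f n)} :=
    fun n r => by rw [hkerL, htr n r]
  /- ### 4. The tower data -/
  obtain ⟨A, hAS⟩ : ∃ A : ℕ → Subalgebra k L, ∀ n, (A n).toSubring = ((R (i₀ + n)).comap Λ.subtype).map φL := by
    choose A hA using fun n => exists_subalgebra_toSubring_eq_map Λ φL hkΛ hφLk (R (i₀ + n)) (hkR n)
    exact ⟨A, hA⟩
  let x : ℕ → L := fun n => φL ⟨xu n, hle n (hxu n)⟩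
  let g : ℕ → L := fun n => φL ⟨Gu n, hle n (hGu n)⟩
  let h : ℕ → L := fun n => φL ⟨s (i₀ + n) ^ 2, hle n (hs n)⟩
  let T : ℕ → L := fun n => Nat.rec T₀ (fun m t => (t - g m) / x m) n
  have hTsucc : ∀ n, T (n + 1) = (T n - g n) / x n := fun n => rfl
  have hT0' : T 0 = T₀ := rfl
  let Y : ℕ → Subalgebra k L := fun n => Algebra.adjoin k (insert (T n) (A n : Set L))
  have hAl : ∀ n, IsLocalRing (A n).toSubring := fun n => by
    rw [hAS n]; exact isLocalRing_map Λ φL (R (i₀ + n)) (hle n)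
  /- ### 5. Per-stage images: membership, the restricted residue maps `ψ n`, (T1) -/
  have hAmem : ∀ n (z : L), z ∈ A n ↔ ∃ r : Λ, (r : K) ∈ R (i₀ + n) ∧ φL r = z := fun n z => by
    rw [← Subalgebra.mem_toSubring, hAS n]; exact mem_map_comap_iff Λ φL _ z
  have hAmemR : ∀ n (r : K) (hr : r ∈ R (i₀ + n)), φL ⟨r, hle n hr⟩ ∈ A n := fun n r hr => (hAmem n _).mpr ⟨_, hr, rfl⟩
  have hψex : ∀ n, ∃ ψ : R (i₀ + n) →+* (A n).toSubring, Function.Surjective ψ ∧ ∀ r, ((ψ r : (A n).toSubring) : L) = φL ⟨(r : K), hle n r.2⟩ := by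
    intro n; rw [hAS n]; exact exists_surjective_restrict Λ φL _ (hle n)
  choose ψ hψs hψv using hψex
  haveI hψloc : ∀ n, IsLocalHom (ψ n) := fun n => IsLocalHom.of_surjective (ψ n) (hψs n)
  have hAmono : ∀ n, A n ≤ A (n + 1) := by
    intro n z hz
    obtain ⟨r, hr, rfl⟩ := (hAmem n z).mp hz
    exact (hAmem (n + 1) _).mpr ⟨r, (hdomR n).1 hr, rfl⟩
  have hT1 : ∀ n, IsRegularLocalRing (A n).toSubring ∧ ringKrullDim (A n).toSubring = (2 : ℕ) ∧ Algebra.EssFiniteType k (A n) ∧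
      ∀ a : (A n).toSubring, ∃ b : (A n).toSubring, a - b ^ 2 ∈ @maximalIdeal _ _ (hAl n) := by
    intro n
    have hreg := isRegularLocalRing_map_of_inv Λ φL hkerL (R (i₀ + n)) (hle n) (hdim n) (δ₁ n (f n)) (δ₂ n (f n)) (htr n) (hrsop n)
    obtain ⟨Bn, hBnO, -, hBnfg, hRBn⟩ := SteeredExit.exists_model_of_tower O B hBO hB
      (R := fun m => R (i₀ + m)) (by simpa using hRB) (N := n) (fun i _ => hbl i)
    have hRBn' : R (i₀ + n) = locAtCentre Bn.toSubring O := by simpa using hRBn.symm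
    have hleBn : locAtCentre Bn.toSubring O ≤ Λ := by rw [← hRBn']; exact hle n
    have hess : Algebra.EssFiniteType k (A n) :=
      essFiniteType_of_toSubring_eq_map_locAtCentre Λ φL hkΛ hφLk O Bn hBnfg hBnO hleBn (A n) (by rw [hAS n, hRBn'])
    haveI := isLocalRing_map Λ φL (R (i₀ + n)) (hle n)
    have hperfA := forall_exists_sub_sq_mem_maximalIdeal_map Λ φL (R (i₀ + n)) (hle n) (hperf n (hl n))
    refine ⟨by rw [hAS n]; exact hreg.1, by rw [hAS n]; exact hreg.2, hess, ?_⟩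
    have key : ∀ (S : Subring L) (hS : S = ((R (i₀ + n)).comap Λ.subtype).map φL) (inst : IsLocalRing S)
        (a : S), ∃ b : S, a - b ^ 2 ∈ @maximalIdeal S _ inst := by
      intro S hS inst a; subst hS; exact hperfA a
    exact key _ (hAS n) (hAl n)
  /- ### 6. The step laws, `x n ≠ 0`, `T n ^ 2 = h n`, (T3), (T4), (T5) -/
  have hlaw : ∀ n, h (n + 1) * x n ^ 2 = h n - g n ^ 2 := fun n =>
    map_strictStep Λ φL (hle n (hs n)) (hle (n + 1) (hs (n + 1))) (hle n (hxu n)) (hle n (hGu n)) (hstep n)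
  have h1q : ∀ n, (1 : R (i₀ + n)) ∉ Ideal.span {δ₁ n (f n), δ₂ n (f n)} :=
    fun n h1 => (hqprime n).ne_top ((Ideal.eq_top_iff_one _).mpr h1)
  have hx0L : ∀ n, x n ≠ 0 := by
    intro n hx
    have h0 : h n - g n ^ 2 = 0 := by rw [← hlaw n, hx]; ring
    apply hT3up n ⟨Gu n, hGu n⟩ 1 (h1q n)
    rw [← htrL n]
    set d : R (i₀ + n) := f n * 1 ^ 2 - ⟨Gu n, hGu n⟩ ^ 2 with hd
    have : (⟨(d : K), hle n d.2⟩ : Λ) = ⟨s (i₀ + n) ^ 2, hle n (hs n)⟩ - ⟨Gu n, hle n (hGu n)⟩ ^ 2 :=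
      Subtype.ext (by rw [hd]; push_cast; ring)
    rw [this, map_sub, map_pow]
    exact h0
  have hTsq : ∀ n, T n ^ 2 = h n := by
    intro n
    induction n with
    | zero => exact hT₀
    | succ n ih =>
      rw [hTsucc]
      exact curveStep_sq ih (by rw [← hlaw n]; ring) (hx0L n)
  have hT3 : ∀ n (u v : L), u ∈ A n → v ∈ A n → v ≠ 0 → (u / v) ^ 2 ≠ h n := by
    intro n u v hu hv hv0 huv
    obtain ⟨ru, hru, rfl⟩ := (hAmem n u).mp hu
    obtain ⟨rv, hrv, rfl⟩ := (hAmem n v).mp hv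
    have hrvq : (⟨(rv : K), hrv⟩ : R (i₀ + n)) ∉ Ideal.span {δ₁ n (f n), δ₂ n (f n)} := by
      rw [← htrL n]; exact hv0
    apply hT3up n ⟨ru, hru⟩ ⟨rv, hrv⟩ hrvq
    rw [← htrL n]
    set d : R (i₀ + n) := f n * ⟨(rv : K), hrv⟩ ^ 2 - ⟨(ru : K), hru⟩ ^ 2 with hd
    have : (⟨(d : K), hle n d.2⟩ : Λ) = ⟨s (i₀ + n) ^ 2, hle n (hs n)⟩ * rv ^ 2 - ru ^ 2 := Subtype.ext rfl
    have huv' : φL ru ^ 2 = h n * φL rv ^ 2 := by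
      rw [div_pow, div_eq_iff (pow_ne_zero 2 hv0)] at huv; exact huv
    rw [this, map_sub, map_mul, map_pow, map_pow, sub_eq_zero]
    exact huv'.symm
  have hnr : ∀ n (u v : (A n).toSubring), (v : L) ≠ 0 → ((u : L) / (v : L)) ^ 2 ≠ h n := fun n u v hv0 => hT3 n u v u.2 v.2 hv0
  have hT4A : ∀ n (hh : h n ∈ A n), ∃ γ : (A n).toSubring, (⟨h n, hh⟩ : (A n).toSubring) - γ ^ 2 ∈ (@maximalIdeal _ _ (hAl n)) ^ 2 := by
    intro n hh
    obtain ⟨γ, hγ⟩ := hT4 n (hl n) (hs n)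
    refine ⟨ψ n γ, ?_⟩
    have hfe : (⟨h n, hh⟩ : (A n).toSubring) = ψ n (f n) := Subtype.ext (hψv n (f n)).symm
    rw [hfe, ← map_pow, ← map_sub]
    have hle2 : (maximalIdeal (R (i₀ + n)) ^ 2).map (ψ n) ≤ (@maximalIdeal _ _ (hAl n)) ^ 2 := by
      rw [Ideal.map_pow]; exact Ideal.pow_right_mono (map_maximalIdeal_le (ψ n)) 2
    exact hle2 (Ideal.mem_map_of_mem _ hγ)
  have hxA : ∀ n, x n ∈ A n := fun n => hAmemR n (xu n) (hxu n)
  have hgA : ∀ n, g n ∈ A n := fun n => hAmemR n (Gu n) (hGu n)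
  have hhA : ∀ n, h n ∈ A n := fun n => hAmemR n _ (hs n)
  have hxm : ∀ n, (⟨x n, hxA n⟩ : (A n).toSubring) ∈ @maximalIdeal _ _ (hAl n) := by
    intro n
    have hxe : (⟨x n, hxA n⟩ : (A n).toSubring) = ψ n ⟨xu n, hxu n⟩ := Subtype.ext (hψv n ⟨xu n, hxu n⟩).symm
    rw [hxe]
    exact map_nonunit (ψ n) _ ((mem_maximalIdeal _).mpr (mem_nonunits_iff.mpr (hxnu n)))
  have hT5 : ∀ n, g n ∈ A n ∧ x n ≠ 0 ∧ (∃ hx : x n ∈ A n, (⟨x n, hx⟩ : (A n).toSubring) ∈ @maximalIdeal _ _ (hAl n)) ∧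
      h (n + 1) * x n ^ 2 = h n - g n ^ 2 ∧ T (n + 1) * x n = T n - g n :=
    fun n => ⟨hgA n, hx0L n, ⟨hxA n, hxm n⟩, hlaw n, by rw [hTsucc, div_mul_cancel₀ _ (hx0L n)]⟩
  /- ### 7. The members `Y n = A n[T n]`: presentation, locality, essential finiteness, fraction field -/
  have hYS : ∀ n, (Y n).toSubring = Subring.closure (insert (T n) ((A n : Set L))) := by
    intro n
    show (Algebra.adjoin k (insert (T n) (A n : Set L))).toSubring = _
    rw [Algebra.adjoin_eq_ring_closure]
    refine le_antisymm (Subring.closure_le.mpr (Set.union_subset ?_ Subring.subset_closure)) (Subring.closure_mono Set.subset_union_right)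
    rintro _ ⟨c, rfl⟩
    exact Subring.subset_closure (Set.mem_insert_of_mem _ ((A n).algebraMap_mem c))
  have hAY : ∀ n, (A n).toSubring ≤ (Y n).toSubring := fun n z hz =>
    (hYS n) ▸ Subring.subset_closure (Set.mem_insert_of_mem _ hz)
  have hTY : ∀ n, T n ∈ Y n := fun n => Algebra.subset_adjoin (Set.mem_insert _ _)
  have hYloc : ∀ n, IsLocalRing (Y n) := by
    intro n
    obtain ⟨c, hc⟩ := (hT1 n).2.2.2 ⟨h n, hhA n⟩
    have key : ∀ (S : Subring L) (hS : S = Subring.closure (insert (T n) ((A n : Set L)))), IsLocalRing S := by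
      intro S hS; subst hS
      exact @isLocalRing_closure_insert L _ _ (A n).toSubring (hAl n) _ _ (hhA n) (hTsq n) c hc (hnr n)
    exact key _ (hYS n)
  have hAY' : ∀ n, A n ≤ Y n := fun n z hz => Algebra.subset_adjoin (Set.mem_insert_of_mem _ hz)
  have hYmono : ∀ n, Y n ≤ Y (n + 1) := by
    intro n
    refine Algebra.adjoin_le ?_
    rintro z (rfl | hz)
    · have hTn : T n = x n * T (n + 1) + g n := by rw [hTsucc, mul_div_cancel₀ _ (hx0L n), sub_add_cancel]
      rw [hTn]
      exact (Y (n + 1)).add_mem ((Y (n + 1)).mul_mem (hAY' (n + 1) (hAmono n (hxA n))) (hTY (n + 1))) (hAY' (n + 1) (hAmono n (hgA n)))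
    · exact hAY' (n + 1) (hAmono n hz)
  have hYess : ∀ n, Algebra.EssFiniteType k (Y n) := fun n => by
    haveI := (hT1 n).2.2.1; exact essFiniteType_adjoin_insert (A n) (T n)
  have hφLdiv : ∀ (a u : K) (ha : a ∈ R i₀) (hu : u ∈ R i₀),
      algebraMap (ResidueField Λ) L (φ ⟨a, h1 ha⟩ / φ ⟨u, h1 hu⟩) = φL ⟨a, h1 ha⟩ / φL ⟨u, h1 hu⟩ := fun a u ha hu => by
    rw [map_div₀]; rfl
  have hY0frac : IsFractionRing (Y 0) L := by
    refine isFractionRing_of_gen (Y 0) (A 0).toSubring (hAY 0) (hTY 0) (fun z => ?_)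
    obtain ⟨c, d, rfl⟩ := hgen z
    obtain ⟨a₁, u₁, ha₁, hu₁, -, hφu₁, rfl⟩ := exists_residue_div_eq (R i₀) Λ 𝔮 h1 h2 h4 c
    obtain ⟨a₂, u₂, ha₂, hu₂, -, hφu₂, rfl⟩ := exists_residue_div_eq (R i₀) Λ 𝔮 h1 h2 h4 d
    have hu₁L : φL ⟨u₁, h1 hu₁⟩ ≠ 0 := fun h0 => hφu₁ ((algebraMap (ResidueField Λ) L).injective (by
      rw [map_zero]; exact h0))
    have hu₂L : φL ⟨u₂, h1 hu₂⟩ ≠ 0 := fun h0 => hφu₂ ((algebraMap (ResidueField Λ) L).injective (by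
      rw [map_zero]; exact h0))
    refine ⟨φL ⟨a₁, h1 ha₁⟩ * φL ⟨u₂, h1 hu₂⟩, φL ⟨a₂, h1 ha₂⟩ * φL ⟨u₁, h1 hu₁⟩, φL ⟨u₁, h1 hu₁⟩ * φL ⟨u₂, h1 hu₂⟩, ?_, ?_, ?_, mul_ne_zero hu₁L hu₂L, ?_⟩
    · exact Subring.mul_mem _ (hAmemR 0 a₁ ha₁) (hAmemR 0 u₂ hu₂)
    · exact Subring.mul_mem _ (hAmemR 0 a₂ ha₂) (hAmemR 0 u₁ hu₁)
    · exact Subring.mul_mem _ (hAmemR 0 u₁ hu₁) (hAmemR 0 u₂ hu₂)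
    · rw [hφLdiv a₁ u₁ ha₁ hu₁, hφLdiv a₂ u₂ ha₂ hu₂, hT0']
      field_simp
  have hYfrac : ∀ n, IsFractionRing (Y n) L := by
    intro n
    induction n with
    | zero => exact hY0frac
    | succ n ih => haveI := ih; exact isFractionRing_of_le (Y n) (Y (n + 1)) (hYmono n)
  /- ### 8. (T6) point stages -/
  have hT6 : ∀ n ∈ pt, @blowupRing _ _ (A n).toSubring (hAl n) (x n) ≤ (A (n + 1)).toSubring ∧
      (∀ z ∈ A (n + 1), ∃ a ∈ @blowupRing _ _ (A n).toSubring (hAl n) (x n), ∃ b ∈ @blowupRing _ _ (A n).toSubring (hAl n) (x n), b⁻¹ ∈ A (n + 1) ∧ z = a / b) ∧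
      SubringDominates (A n).toSubring (A (n + 1)).toSubring ∧
      IsQuadraticTransform (Y n).toSubring (Y (n + 1)).toSubring := by
    intro n hn
    obtain ⟨hdiv, hRe⟩ := hptd n hn
    have e : R (i₀ + (n + 1)) = locAtCentre (blowupRing (R (i₀ + n)) (xu n)) O := hRe (hl n)
    obtain ⟨hbl', hfrac', hdomA⟩ := pointStep_images Λ φL hkerL' O (R (i₀ + n)) (R (i₀ + (n + 1))) (hle n) (hle (n + 1))
      (hRO n) (xu n) (hxu n) (hxnu n) (hx0 n) hdiv e (hdomR n) (hx0L n) _ _ (hAS n) (hAS (n + 1)) (hAl n)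
    refine ⟨hbl', hfrac', hdomA, ?_⟩
    obtain ⟨c', hc'⟩ := (hT1 (n + 1)).2.2.2 ⟨h (n + 1), hhA (n + 1)⟩
    haveI := hAl n; haveI := hAl (n + 1)
    have hq := pointStep_isQuadraticTransform (A n).toSubring (A (n + 1)).toSubring (fun z hz => hAmono n hz) (x n)
      (hxA n) (hxm n) (hx0L n) hbl' hfrac' hdomA (hhA n) (hgA n) (hhA (n + 1)) (hTsq n) (hlaw n) (hnr n) (hnr (n + 1))
      c' hc'
    rw [hYS n, hYS (n + 1), hTsucc]
    exact hq
  /- ### 9. (T7) curve stages -/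
  have hT7 : ∀ n ∉ pt, A (n + 1) = A n ∧ ((Y n).toSubring ≤ (Y (n + 1)).toSubring ∧
        (Y n).toSubring ≠ (Y (n + 1)).toSubring ∧ IsLocalRing (Y (n + 1)).toSubring ∧
        ∀ z ∈ (Y (n + 1)).toSubring, ∃ q : Polynomial L, q.Monic ∧ (∀ i, q.coeff i ∈ (Y n).toSubring) ∧ q.eval z = 0) ∧
      ¬ IsQuadraticTransform (Y n).toSubring (Y (n + 1)).toSubring := by
    intro n hn
    obtain ⟨S, hSO, hSr, hRe⟩ := hcvd n hn
    have e : R (i₀ + (n + 1)) = locAtCentre (Subring.closure ((R (i₀ + n) : Set K) ∪ ↑S)) O := hRe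
    have himg := curveStep_images Λ φL hkerL O (R (i₀ + n)) (R (i₀ + (n + 1))) (hle n) (hle (n + 1)) (hRO n) S hSO hSr e (hdomR n)
    have hAeq : A (n + 1) = A n := Subalgebra.toSubring_injective (by rw [hAS, hAS, himg])
    have hh'A : h (n + 1) ∈ A n := hAeq ▸ hhA (n + 1)
    haveI := hAl n
    haveI : IsRegularLocalRing (A n).toSubring := (hT1 n).1
    haveI : IsLocalRing (Y n).toSubring := hYloc n
    have hY'S : (Y (n + 1)).toSubring = Subring.closure (insert (T (n + 1)) ((A n : Set L))) := by rw [hYS (n + 1), hAeq]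
    refine ⟨hAeq, ⟨hYmono n, ?_, hYloc (n + 1), ?_⟩, ?_⟩
    · rw [hYS n, hY'S, hTsucc]
      exact closure_insert_ne_curveStep (A n).toSubring (hhA n) (hTsq n) (hnr n) (hgA n) (hxA n) (hxm n) (hx0L n)
    · rw [hYS n, hY'S]
      exact curveStep_integral (A n).toSubring hh'A (hTsq (n + 1))
    · exact not_isQuadraticTransform_curveStep (A n).toSubring (Y n).toSubring (Y (n + 1)).toSubring
        (by rw [(hT1 n).2.1]; exact le_of_eq (by norm_cast)) (hhA n) (hTsq n) hh'A (hTsq (n + 1)) (hYS n) hY'S (hYmono n)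
  /- ### 10. (T0) the transcendence degree -/
  have hT0 : Algebra.trdeg k L = 2 := by
    haveI := halg
    haveI : IsLocalRing (R i₀) := hlI 0
    exact trdeg_eq_two_of_critical O hzd (R i₀) B hB hBO hRB (hdim 0) 𝔮 Λ h1 h2 h4 (δ₁ 0 (f 0)) (δ₂ 0 (f 0)) (htr 0) (hrsop 0) (fun c => ⟨hkΛ c, rfl⟩) L
  /- ### 11. Assembly -/
  refine ⟨L, _instL, algkL, A, Y, h, T, x, g, inferInstance, hAl, hT0, hT1,
    fun n => ⟨hhA n, hTsq n, hYS n, hYloc n, hYess n, hYfrac n⟩, hT3, hT4A, hT5, hT6, hT7, ?_⟩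
  /- ### 12. (T9) σ_top read on the surface -/
  intro n hn Q _ hQ0 hQm hQreg hh hsing
  haveI := hAl n
  have hkerψ : ∀ r : R (i₀ + n), ψ n r = 0 ↔ ¬ IsUnit (⟨(r : K), hle n r.2⟩ : Λ) := fun r => by
    rw [← hkerL, ← hψv n r]
    exact ⟨fun h0 => by rw [h0]; rfl, fun h0 => Subtype.ext h0⟩
  have hfe : (⟨h n, hh⟩ : (A n).toSubring) = ψ n (f n) := Subtype.ext (hψv n (f n)).symm
  rw [hfe] at hsing
  exact hsing (hT9 n hn (hle n) (hs n) (A n).toSubring (ψ n) (hψs n) hkerψ Q hQ0 hQm hQreg)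

end Summit.ResolutionOfSingularities.ResolutionOfSingularities.Theorems.SwitchingDichotomy.LowTower

end
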